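import Mathlib.NumberTheory.Padics.Complex
import Literature.NumberTheory.EllipticCurves.Newforms
import HarnessLib

/-!
# The Katz–Carayol cuspidal lift (Billerey–Menares 2018, §3.2, input (K)) — the named fact

Topic `Literature/NumberTheory/ModularForms`. ONE named fact (D-0014), no proofs:
`Carayol1989_cuspForm_lift`, VERBATIM the hypothesis binder `hK` of the accepted reduction
`Literature.NumberTheory.EllipticCurves.BillereyMenares2018_exists_newform_of_cuspidalLift`
(`EllipticCurves/EisensteinSeriesWeightTwoCharacter.lean` ll. 431–447; the primary reduction is
`…_of_cuspidalLift_of_weightTwoEisenstein`, `EisensteinNewformLevelRaisingReductionProofs.lean`:280,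
whose other input (E₂) is now the theorem `exists_weightTwoEisenstein`) — librarian sweep g24,
vend-from-binder, promote events 3296054 / 3219970 (the provefact seat may not mint it,
`lint.fact-fanout`). First consumer: that reduction, whence
`BillereyMenares2018_exists_newform_holds := …_of_cuspidalLift Carayol1989_cuspForm_lift_holds`.

Shape. This is the shape `hK` WITH the printed side conditions on the nebentypus — parity
`χ(−1) = (−1)^k` and order prime to `p` (`χ^m = 1` for some `m` with `p ∤ m`) — i.e. exactly what
Billerey–Menares use ("nebentypus `χ` of order prime to `p`"). The companion binder `hlift` of
`BillereyMenares2018_exists_newform_of_cuspFormLift` (same file, ll. 450–462) drops both conditions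
and is therefore a STRONGER statement; it is deliberately NOT the one vendored here (the 2016 odd-prime
route that wanted it is now served by `Edixhoven1997_exists_integralForm_cuspIndicator` instead,
`IntegralCuspIndicatorForms.lean`). `hK` follows from `hlift` trivially.

## Source and reading

Billerey–Menares, *Strong modularity of reducible Galois representations*, Trans. AMS 370 (2018),
§3.2, the step "(K)": Katz's `q`-expansion principle (Katz 1973, Cor. 1.6.2, §1.7) with Carayol's
Lemma (Carayol 1989, §4.4; Edixhoven 1997, Prop. 1.10 p. 222 with Lemma 1.9 p. 218; Diamond–Im 1995,
Thm. 12.3.4, Rem. 12.3.5, Thm. 12.3.7): for a prime `p ≥ 5`, a level `L` with `p ∤ L`, a weight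
`k ≥ 2` and a Dirichlet character `χ` mod `L` with `χ(−1) = (−1)^k` and of order prime to `p`, every
holomorphic `F ∈ M_k(Γ₁(L))` with nebentypus `χ` (`F ∣[k] γ = χ(d_γ) F` for `γ ∈ Γ₀(L)`), with
`ℤ̄_p`-integral `q`-expansion at `∞` (through a fixed `ι : ℚ̄_p ≃ ℂ`) and with ALL constant terms
(`lim_{i∞} F ∣[k] γ`, `γ ∈ SL₂(ℤ)`) in the maximal ideal, is congruent modulo the maximal ideal to a
CUSP form `G ∈ S_k(L, χ)` (`G ∈ nebentypusSubspace L k χ`, `Newforms.lean`):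
`v(ι⁻¹(aₙ(G) − aₙ(F))) < 1` for all `n`.

What is deliberately NOT here: the mod-`p` `q`-expansion principle and the geometry of `X₁(L)` over
`ℤ_p` from which (K) is proved; the weight-one and `p ≤ 3` cases.
-/

noncomputable section

open scoped MatrixGroups ModularForm Topology
open CongruenceSubgroup UpperHalfPlane Filter

namespace Literature.NumberTheory.ModularForms

open Literature.NumberTheory.EllipticCurves.ModularForms

/-- **The Katz–Carayol cuspidal lift (Billerey–Menares 2018 §3.2 (K); Carayol 1989 §4.4,
Edixhoven 1997 Prop. 1.10, Katz 1973 §1.7).** For every prime `p ≥ 5`, every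
`ι : PadicAlgCl p ≃+* ℂ`, every level `L` with `p ∤ L`, every weight `k ≥ 2`, every Dirichlet
character `χ` mod `L` with `χ(−1) = (−1)^k` and of order prime to `p`, and every modular form
`F ∈ M_k(Γ₁(L))` with nebentypus `χ` on `Γ₀(L)`, `p`-integral `q`-expansion
(`Valued.v (ι.symm aₙ(F)) ≤ 1`) and every constant term in the maximal ideal
(`F ∣[k] γ → c` at `i∞` with `Valued.v (ι.symm c) < 1`, all `γ ∈ SL(2, ℤ)`), there is a cusp form
`G ∈ S_k(Γ₁(L))` in the `χ`-nebentypus subspace with `G ≡ F` modulo the maximal ideal coefficientwise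
(`Valued.v (ι.symm (aₙ(G) − aₙ(F))) < 1`). VERBATIM the binder `hK` of
`Literature.NumberTheory.EllipticCurves.BillereyMenares2018_exists_newform_of_cuspidalLift`; users
take `(hK : Carayol1989_cuspForm_lift)`. Named fact (D-0014), not proved in the tree.
[cite: BillereyMenares2018, §3.2 (the cuspidal lift (K)), with Thm. 1 and Thm. 2]
[cite: Carayol1989, §4.4] [cite: Edixhoven1997, Prop. 1.10 p. 222 and Lemma 1.9 p. 218]
[cite: Katz1973, Cor. 1.6.2 and §1.7] [cite: DiamondIm1995, Thm. 12.3.4, Rem. 12.3.5, Thm. 12.3.7] -/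
def Carayol1989_cuspForm_lift : Prop :=
  ∀ (p : ℕ) [Fact p.Prime], 5 ≤ p → ∀ (ι : PadicAlgCl p ≃+* ℂ) (L : ℕ) [NeZero L],
    ¬ p ∣ L → ∀ (k : ℤ), 2 ≤ k → ∀ (χ : DirichletCharacter ℂ L) (F : ModularForm (Gamma1 L) k),
      χ (-1) = (-1) ^ k → (∃ m : ℕ, 0 < m ∧ ¬ p ∣ m ∧ χ ^ m = 1) →
      (∀ γ : SL(2, ℤ), γ ∈ Gamma0 L →
        (⇑F : ℍ → ℂ) ∣[k] γ = χ ((γ 1 1 : ℤ) : ZMod L) • (⇑F : ℍ → ℂ)) →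
      (∀ n : ℕ, Valued.v (ι.symm ((qExpansion 1 ⇑F).coeff n)) ≤ 1) →
      (∀ γ : SL(2, ℤ), ∃ c : ℂ,
        Tendsto ((⇑F : ℍ → ℂ) ∣[k] γ) atImInfty (𝓝 c) ∧ Valued.v (ι.symm c) < 1) →
      ∃ G : CuspForm (Gamma1 L) k, G ∈ nebentypusSubspace L k χ ∧
        ∀ n : ℕ, Valued.v (ι.symm ((qExpansion 1 ⇑G).coeff n - (qExpansion 1 ⇑F).coeff n)) < 1

end Literature.NumberTheory.ModularForms

end
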